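import Summits.CriticalPhenomena.PercolationContinuityZ3.Theorems.Transplant.HexShadowTransport
import HarnessLib

/-!
# HEXAGONAL SHADOWS V — the FACE-neighbour coarse lattice: the good-edge geometry Duminil-Copin–Sidoravicius–Tassion's §2.1 actually delivers in
# hexagonal symmetry; its nodes, assembly and translation invariance

builds on p205010 (kernel theorem, internal audit signed; external expert review pending) — NOT used in this file.
Lane `prim-bschramm`, seat `prim-bschramm-p2` (gen 31; class C1b; memo `HOME/bschramm/P2-LATTICES.md` §110–§111); helper file
(`--supports stmt-CriticalPhenomena-4575 --as helper`).  Interface `Transplant/HexShadowDefs`, tools `Transplant/HexShadowTransport`.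

WHY A SECOND COARSE LATTICE.  In DST's three-box argument (§2.1, eqs. (10)–(13)) the landing zone `Z_n` lies on a SIDE of the big box `B_{3n}` and the
auxiliary box `B'_n = (2n, y) + B_n` has its side on the same LINE; the mirror across the side-parallel line through the centre of `B'_n` carries `B_{3n}`
to its FACE neighbour `(4n,0) + B_{3n}`.  For the lattice hexagon `hexBall c 3n` (sides on the lines `{(z−c)₀ = 3n}` etc., of direction `e₁`) the same
mirror (the `D₆` mirror with axis of direction `e₁` through `c' = c + (2n, y')`, `(a,b) ↦ (−a, a+b)`) carries `c` to `c + 2n·(2,−1)` WHATEVER `y'` is: the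
displacement is `2n` times an APOTHEM vector of `𝕋` (`triNorm = 2`; the apothem vectors `±(2,−1), ±(1,1), ±(−1,2)` are the centres of the hexagons
tiling the plane face to face), not `4n` times a unit (vertex) vector as in `HexShadow.goodEvent` of `HexShadowDefs` §3–§4, which therefore remains
a vertex-direction VARIANT only.  This file sets up the face-direction route the `(111)`-films use: coarse directions `faceDir 0 = (2,−1)`,
`faceDir 1 = (1,1)` (60° apart — exchanged by the `D₆` mirror with axis `e₀`, `(a,b) ↦ (a+b, −b)` — so the coarse graph is again `ℤ²`), coarse step
`2n·faceDir i` (`triNorm`-length `4n`), region `hexBall (z + n·faceDir i) 6n`, blocks `hexBall · 3n`, inner hexagons `hexBall · u` (`u ≤ n`): DST's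
numerology with all `triNorm`-distances unchanged.
* §1 `faceDir`, `triNorm_natMul_faceDir`, `hexBall_subset_faceRegion`; §2 **`HexShadow.faceGoodEvent`**, locality, continuity, translation
  invariance **`real_faceGoodEvent_shift`**; §3 NODES **`FaceGoodEventLikely`** (DST §2.1, the node Lemmata 4–6 prove) and **`FaceRenormalisation`**
  (DST §2.2, PROVED for connected `G` in `Transplant/HexShadowFaceRenorm`), ASSEMBLY **`theta_criticalProb_eq_zero_of_faceNodes`** PROVED.
[cite: DuminilCopinSidoraviciusTassion2016, §2.1 eqs. (10)–(13), §2.2 (arXiv 1401.7130 pp. 5–9)] [cite: GrimmettPercolation1999, §1.6 p. 16]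
[cite: BenjaminiSchramm1996, Conj. 4 / Question 3]
-/

noncomputable section

namespace Summit.CriticalPhenomena.PercolationContinuityZ3.Theorems.Transplant

open MeasureTheory Literature.Probability.Percolation Literature.Probability.LatticeModels SimpleGraph Filter
open scoped Classical Topology

/-! ## §1 The face directions -/

/-- The two FACE (apothem) directions of the coarse lattice: `(2,−1)` and `(1,1)`. [cite: DuminilCopinSidoraviciusTassion2016, §2.1 (the reflection across {2n} × ℝ) and §2.2] -/
def faceDir : Fin 2 → Site 2 := ![![2, -1], ![1, 1]]

/-- `faceDir 0 = (2, −1)`. [folklore] -/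
@[simp] theorem faceDir_zero : faceDir 0 = ![2, -1] := rfl

/-- `faceDir 1 = (1, 1)`. [folklore] -/
@[simp] theorem faceDir_one : faceDir 1 = ![1, 1] := rfl

/-- The face directions have `triNorm` two: `triNorm (m • faceDir i) = 2m`. [folklore] -/
theorem triNorm_natMul_faceDir (m : ℕ) (i : Fin 2) : triNorm ((m : ℤ) • faceDir i) = 2 * m := by
  have hm : (0 : ℤ) ≤ m := Nat.cast_nonneg m
  fin_cases i
  · have e : ((m : ℤ) • faceDir 0 : Site 2) = ![2 * (m : ℤ), -(m : ℤ)] := by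
      ext j; fin_cases j <;> simp [faceDir]
      ring
    simp only [Fin.zero_eta, e, triNorm, Matrix.cons_val_zero, Matrix.cons_val_one]
    rw [abs_of_nonneg (by linarith), abs_of_nonpos (by linarith), show 2 * (m : ℤ) + -(m : ℤ) = m by ring, abs_of_nonneg hm,
      neg_neg, max_self, max_eq_left (by linarith)]
  · have e : ((m : ℤ) • faceDir 1 : Site 2) = ![(m : ℤ), (m : ℤ)] := by
      ext j; fin_cases j <;> simp [faceDir]
    simp only [Fin.mk_one, e, triNorm, Matrix.cons_val_zero, Matrix.cons_val_one]
    rw [abs_of_nonneg hm, show (m : ℤ) + m = 2 * m by ring, abs_of_nonneg (by linarith)]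
    simp only [max_eq_right (show (m : ℤ) ≤ 2 * m by linarith)]

/-- … and so have their negatives. [folklore] -/
theorem triNorm_neg_natMul_faceDir (m : ℕ) (i : Fin 2) : triNorm (-((m : ℤ) • faceDir i)) = 2 * m := by
  rw [← triNorm_natMul_faceDir m i]; simp only [triNorm, Pi.neg_apply, ← neg_add, abs_neg]

/-- The triangle inequality for `triNorm` (private copy; the statement lives in unrelated files not imported here). [folklore] -/
private theorem triNorm_add_le₅ (v w : Site 2) : triNorm (v + w) ≤ triNorm v + triNorm w := by
  simp only [triNorm, Pi.add_apply, max_le_iff]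
  have l0 := (abs_le_triNorm v).1; have l1 := (abs_le_triNorm v).2
  have l2 : |v 0 + v 1| ≤ triNorm v := (le_max_right _ _).trans (le_max_right _ _)
  have m0 := (abs_le_triNorm w).1; have m1 := (abs_le_triNorm w).2
  have m2 : |w 0 + w 1| ≤ triNorm w := (le_max_right _ _).trans (le_max_right _ _)
  simp only [triNorm] at l0 l1 l2 m0 m1 m2 ⊢
  rw [abs_le] at l0 l1 l2 m0 m1 m2
  refine ⟨abs_le.2 ⟨?_, ?_⟩, abs_le.2 ⟨?_, ?_⟩, abs_le.2 ⟨?_, ?_⟩⟩ <;> linarith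

/-- The block `hexBall z 3n` and its face neighbour's block lie in the region `hexBall (z + n·faceDir i) 6n`. [cite: DuminilCopinSidoraviciusTassion2016, §2.2] -/
theorem hexBall_subset_faceRegion (n : ℕ) (z : Site 2) (i : Fin 2) :
    hexBall z (3 * n) ⊆ hexBall (z + (n : ℤ) • faceDir i) (6 * n) ∧
      hexBall (z + (2 * (n : ℤ)) • faceDir i) (3 * n) ⊆ hexBall (z + (n : ℤ) • faceDir i) (6 * n) := by
  have h2 := triNorm_natMul_faceDir n i
  have hneg := triNorm_neg_natMul_faceDir n i
  constructor
  · intro w hw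
    rw [mem_hexBall] at hw ⊢
    have e : w - (z + (n : ℤ) • faceDir i) = (w - z) + -((n : ℤ) • faceDir i) := by abel
    rw [e]; have := triNorm_add_le₅ (w - z) (-((n : ℤ) • faceDir i)); push_cast at hw ⊢; linarith
  · intro w hw
    rw [mem_hexBall] at hw ⊢
    have e : w - (z + (n : ℤ) • faceDir i) = (w - (z + (2 * (n : ℤ)) • faceDir i)) + (n : ℤ) • faceDir i := by
      rw [show (2 * (n : ℤ)) • faceDir i = (n : ℤ) • faceDir i + (n : ℤ) • faceDir i by rw [← add_smul]; ring_nf]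
      abel
    rw [e]; have := triNorm_add_le₅ (w - (z + (2 * (n : ℤ)) • faceDir i)) ((n : ℤ) • faceDir i)
    push_cast at hw ⊢; linarith

namespace HexShadow

variable {V : Type} {G : SimpleGraph V} (Φ : HexShadow G)

/-! ## §2 The face good-edge event -/

/-- **The good-edge event of the FACE-neighbour coarse lattice** for the coarse edge `{z, z + 2n·faceDir i}`: `z + S ⟷^{R} z' + S` with `S = hexBall · u`,
`R = hexBall (z + n·faceDir i) 6n`, and a unique cluster of each block `hexBall · 3n` joining `S` to the block boundary.
[cite: DuminilCopinSidoraviciusTassion2016, §2.2 (definition of a good edge)] -/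
def faceGoodEvent (n u : ℕ) (z : Site 2) (i : Fin 2) : Set (BondConfig V) :=
  Φ.conn (hexBall (z + (n : ℤ) • faceDir i) (6 * n)) (hexBall z u) (hexBall (z + (2 * (n : ℤ)) • faceDir i) u) ∩
    (Φ.uniqueConn (hexBall z (3 * n)) (hexBall z u) (hexSphere z (3 * n)) ∩
      Φ.uniqueConn (hexBall (z + (2 * (n : ℤ)) • faceDir i) (3 * n)) (hexBall (z + (2 * (n : ℤ)) • faceDir i) u)
        (hexSphere (z + (2 * (n : ℤ)) • faceDir i) (3 * n)))

/-- The face good-edge event is determined by the edges over its region. [cite: DuminilCopinSidoraviciusTassion2016, §2.2] -/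
theorem determinedBy_faceGoodEvent (n u : ℕ) (z : Site 2) (i : Fin 2) :
    DeterminedBy (Φ.faceGoodEvent n u z i) (Set.sym2 (Φ.lift (hexBall (z + (n : ℤ) • faceDir i) (6 * n)))) :=
  (Φ.determinedBy_conn _ _ subset_rfl).inter
    ((Φ.determinedBy_uniqueConn _ _ (hexBall_subset_faceRegion n z i).1).inter (Φ.determinedBy_uniqueConn _ _ (hexBall_subset_faceRegion n z i).2))

/-- The face good-edge event is a local event. [cite: DuminilCopinSidoraviciusTassion2016, §2.2] -/
theorem isLocalEvent_faceGoodEvent (n u : ℕ) (z : Site 2) (i : Fin 2) : IsLocalEvent (Φ.faceGoodEvent n u z i) :=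
  ⟨(finite_sym2 (Φ.lift_finite (hexBall_finite _ _))).toFinset, by rw [Set.Finite.coe_toFinset]; exact Φ.determinedBy_faceGoodEvent n u z i⟩

/-- The face good-edge event is measurable. [cite: DuminilCopinSidoraviciusTassion2016, §2.2] -/
theorem measurableSet_faceGoodEvent (n u : ℕ) (z : Site 2) (i : Fin 2) : MeasurableSet (Φ.faceGoodEvent n u z i) :=
  measurableSet_of_isLocalEvent_holds (Φ.isLocalEvent_faceGoodEvent n u z i)

/-- The probability of the face good-edge event is continuous in the density. [cite: DuminilCopinSidoraviciusTassion2016, §2.2] -/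
theorem continuous_real_faceGoodEvent [Countable V] (n u : ℕ) (z : Site 2) (i : Fin 2) :
    Continuous fun q : unitInterval => (bondPercolation G q).real (Φ.faceGoodEvent n u z i) :=
  continuous_bondPercolation_real_of_isLocalEvent G (Φ.isLocalEvent_faceGoodEvent n u z i)

/-- **Translation invariance of the face good-edge probability**: the coarse edge at `z + period•t` is good with the probability of the coarse edge at `z`.
[cite: DuminilCopinSidoraviciusTassion2016, §2.2 ("the probability to be good")] -/
theorem real_faceGoodEvent_shift [Countable V] (p : unitInterval) (n u : ℕ) (z t : Site 2) (i : Fin 2) :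
    (bondPercolation G p).real (Φ.faceGoodEvent n u (z + (Φ.period : ℤ) • t) i) = (bondPercolation G p).real (Φ.faceGoodEvent n u z i) := by
  obtain ⟨α, hα⟩ := Φ.shift t
  set c : Site 2 := (Φ.period : ℤ) • t with hc
  have hαg : ∀ w, Φ.sh (α w) = Equiv.addRight c (Φ.sh w) := fun w => by rw [Equiv.coe_addRight, hα]
  have key := Φ.real_conn_inter_image α (Equiv.addRight c) hαg p
    (hexBall (z + (n : ℤ) • faceDir i) (6 * n)) (hexBall z u) (hexBall (z + (2 * (n : ℤ)) • faceDir i) u)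
    (hexBall z (3 * n)) (hexBall z u) (hexSphere z (3 * n))
    (hexBall (z + (2 * (n : ℤ)) • faceDir i) (3 * n)) (hexBall (z + (2 * (n : ℤ)) • faceDir i) u) (hexSphere (z + (2 * (n : ℤ)) • faceDir i) (3 * n))
  simp only [image_addRight_hexBall, image_addRight_hexSphere] at key
  have e1 : z + (n : ℤ) • faceDir i + c = z + c + (n : ℤ) • faceDir i := by abel
  have e2 : z + (2 * (n : ℤ)) • faceDir i + c = z + c + (2 * (n : ℤ)) • faceDir i := by abel
  rw [e1, e2] at key
  unfold faceGoodEvent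
  exact key

/-! ## §3 The two face nodes and the assembly -/

/-- **NODE A (face lattice) — DST §2.1 with eq. (1), (13) in hexagonal geometry**: `θ_v(p) > 0` ⇒ for every `η > 0` some admissible block size `n`
(a positive multiple of the period) and inner radius `u ≤ n` make BOTH face coarse edges at the centre good with `P_p`-probability `> 1 − η`.  The node
DST's Lemmata 4–6 prove (internal obligation, never asserted). [cite: DuminilCopinSidoraviciusTassion2016, §2.1 Lemma 4–6, eq. (1), (13)] -/
def FaceGoodEventLikely {V : Type} {G : SimpleGraph V} (Φ : HexShadow G) [Countable V] : Prop :=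
  ∀ (v : V) (p : unitInterval), 0 < theta G v p → ∀ η : ℝ, 0 < η →
    ∃ n u : ℕ, 1 ≤ n ∧ Φ.period ∣ n ∧ u ≤ n ∧ ∀ i : Fin 2, 1 - η < (bondPercolation G p).real (Φ.faceGoodEvent n u Φ.centre i)

/-- **NODE B (face lattice) — DST §2.2**: some `η > 0` such that face good edges at the centre likely at `q` ⇒ `p_c(G, v) ≤ q` at every vertex (internal
obligation; PROVED for connected `G` in `Transplant/HexShadowFaceRenorm`). [cite: DuminilCopinSidoraviciusTassion2016, §2.2] -/
def FaceRenormalisation {V : Type} {G : SimpleGraph V} (Φ : HexShadow G) [Countable V] : Prop :=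
  ∃ η : ℝ, 0 < η ∧ ∀ n u : ℕ, 1 ≤ n → Φ.period ∣ n → u ≤ n → ∀ q : unitInterval,
    (∀ i : Fin 2, 1 - η < (bondPercolation G q).real (Φ.faceGoodEvent n u Φ.centre i)) → ∀ v : V, criticalProb G v ≤ (q : ℝ)

/-- **`θ_v(p) > 0 ⇒ p_c(G,v) < p` from the two face nodes** (continuity of the local face good-edge probabilities).
[cite: DuminilCopinSidoraviciusTassion2016, §2.2 (p. 6)] -/
theorem criticalProb_lt_of_faceNodes [Countable V] (hA : Φ.FaceGoodEventLikely) (hB : Φ.FaceRenormalisation) (v : V) (p : unitInterval)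
    (hθ : 0 < theta G v p) : criticalProb G v < (p : ℝ) := by
  obtain ⟨η, hη, hR⟩ := hB
  obtain ⟨n, u, hn, hdvd, hu, hgood⟩ := hA v p hθ η hη
  set U : Set unitInterval := {q | ∀ i : Fin 2, 1 - η < (bondPercolation G q).real (Φ.faceGoodEvent n u Φ.centre i)} with hU
  have hUo : IsOpen U := by
    rw [hU, Set.setOf_forall]
    exact isOpen_iInter_of_finite fun i => isOpen_lt continuous_const (Φ.continuous_real_faceGoodEvent n u Φ.centre i)
  have hp0 : 0 < (p : ℝ) := coe_pos_of_theta_pos hθ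
  obtain ⟨ε, hε, hball⟩ := Metric.isOpen_iff.1 hUo p hgood
  let q : unitInterval := ⟨max 0 ((p : ℝ) - ε / 2), le_max_left _ _, max_le zero_le_one (by linarith [p.2.2])⟩
  have hqp : (q : ℝ) < p := by
    change max 0 ((p : ℝ) - ε / 2) < p
    exact max_lt hp0 (by linarith)
  have hqU : q ∈ U := by
    apply hball
    rw [Metric.mem_ball, Subtype.dist_eq, Real.dist_eq, abs_sub_lt_iff]
    change max 0 ((p : ℝ) - ε / 2) - p < ε ∧ (p : ℝ) - max 0 ((p : ℝ) - ε / 2) < ε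
    constructor
    · linarith [hqp]
    · have : (p : ℝ) - ε / 2 ≤ max 0 ((p : ℝ) - ε / 2) := le_max_right _ _
      linarith
  exact (hR n u hn hdvd hu q hqU v).trans_lt hqp

/-- **THE ASSEMBLY (face lattice): NODE A ∧ NODE B ⇒ `θ_v(p_c(G, v)) = 0` at every vertex.**
[cite: DuminilCopinSidoraviciusTassion2016, Thm. 1 and §2] [cite: BenjaminiSchramm1996, Conj. 4 / Question 3] -/
theorem theta_criticalProb_eq_zero_of_faceNodes [Countable V] (hA : Φ.FaceGoodEventLikely) (hB : Φ.FaceRenormalisation) (v : V) :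
    theta G v (criticalProbIOf G v) = 0 := by
  by_contra hne
  have h0 : 0 ≤ theta G v (criticalProbIOf G v) := measureReal_nonneg
  have hpos : 0 < theta G v (criticalProbIOf G v) := lt_of_le_of_ne h0 (Ne.symm hne)
  have hlt := Φ.criticalProb_lt_of_faceNodes hA hB v (criticalProbIOf G v) hpos
  exact lt_irrefl _ (by simpa only [criticalProbIOf] using hlt)

end HexShadow

end Summit.CriticalPhenomena.PercolationContinuityZ3.Theorems.Transplant

end
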